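import Literature.Computability.MetaComplexity.ConstructiveSeparations
import Literature.Computability.Complexity.UniformProbBlocks
import Literature.Computability.Complexity.BPPErrorReductionStrong
import Literature.Computability.Complexity.IterateFPPoly
import Literature.Computability.Complexity.NatSqrtFP
import Literature.Computability.Complexity.UnaryBricks
import HarnessLib

/-!
# The search-to-decision list-refuter of Chen–Jin–Santhanam–Williams (engine)

Literature / meta-complexity toolkit: the machine behind Thm. 1.2 of

* L. Chen, C. Jin, R. Santhanam, R. Williams, *Constructive separations and their consequences*,
  FOCS 2021 / TheoretiCS 3 (2024) = arXiv:2203.14379, §5.1, proof of the theorem "Refuters for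
  `PSPACE`, `EXP`, `NEXP`" (Thm. 5.2 of the arXiv version) and Lemma 5.1 (constant-size
  list-refuters give refuters) [ChenEtAl2022],

for the randomised case `𝒞 = BPP`, parametrised by the data the proof fixes once the language `L`,
the refuted `BPP` language `A` and the class `𝒟` are given (`RefuterKit`): the two Karp reductions
`f₁`, `f₀` (of the prefix-search languages `G¹`, `(G⁰)ᶜ` to `L`), the length-padding map `padS` of
`L`, the amplified witness language `A' ∈ P` of `A` with its coin polynomial `qA`
(`BPP_subset_bpErr_two_pow`), and the query-length polynomial `ℓ`.

Contents (all definitions with bodies, all statements proved):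

* the PURE MODEL of one round of the prefix search (`RefuterKit.pureStep`: extend the prefix `x` by
  `0`, else by `1`, else stop, reading the two `G`-bits off four fresh coin blocks) and of the
  CANONICAL run (`RefuterKit.canonStep`, the same with the true answers `[q ∈ A]`), the coupling
  lemma `iterate_pureStep_eq_canon` ("if every block answers its canonical query correctly, the run
  is the canonical run") and the union bound `uniformProb_not_good_le`
  (`uniformProb_exists_badBlock_le`: `4n` blocks, each wrong with probability `≤ 2^{-ℓ(n)}`);
* the combinatorial heart `exists_slot_error` (the three cases `|x| = 0`, `0 < |x| < n`, `|x| = n`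
  of the printed proof): if `A` errs on some input of length `n`, one of the seven canonical list
  entries — the final prefix and the six queries at `x`, `x0`, `x1` — is an input on which `A` errs;
* the BRICK realisation (`RefuterKit.body`, `loopF`, `slotF`, …) in the `FP` algebra of
  `BrickAlgebra.lean` (counted loop `Brick.loopStep`), its value lemmas and `FP` membership, and the
  seven randomised algorithms `RefuterKit.refuter i : RandAlg ℕ (List Bool)` with exactly polynomial
  coin budgets, their polynomial time (`isPolyTime_refuter`) and success bound (`pr_refuter_ge`).

## References

* [ChenEtAl2022] §5.1 (Thm. 5.2, Lemma 5.1, Cor. 5.3), Def. 1.1.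
* S. Arora, B. Barak, *Computational Complexity: A Modern Approach*, CUP 2009, Thm. 7.10 (error
  reduction), §7.4.1 (union bound), §1.3 (bounded loops) [AroraBarak2009].
-/

namespace Literature.Computability.MetaComplexity

open _root_.Computability Literature.Computability.Complexity Polynomial Brick Plumb Filter

/-- **The data of the list-refuter** (Chen–Jin–Santhanam–Williams 2022, proof of Thm. 5.2): the
Karp reductions `f₁`, `f₀` of the two prefix-search languages to `L`, the length padding `padS` of
`L` (on `⟨x, 1ᵐ⟩`), the amplified witness language `A'` of the refuted algorithm with its coin
polynomial `qA`, and the query-length polynomial `ℓ`. [cite: ChenEtAl2022, §5.1 (proof of Thm. 5.2)] -/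
structure RefuterKit where
  /-- Reduction of `G¹ = {⟨1ⁿ, z⟩ | ∃ y ∈ {0,1}ⁿ, z ⊑ y, y ∈ L ∖ A}` to `L`. -/
  f₁ : List Bool → List Bool
  /-- Reduction of `(G⁰)ᶜ`, `G⁰ = {⟨1ⁿ, z⟩ | ∃ y ∈ {0,1}ⁿ, z ⊑ y, y ∈ A ∖ L}`, to `L`. -/
  f₀ : List Bool → List Bool
  /-- Length padding of `L`: `⟨x, 1ᵐ⟩ ↦` an equivalent instance of length `m` (`|x| ≤ m`). -/
  padS : List Bool → List Bool
  /-- Amplified witness language of the refuted `BPP` language (`BPP_subset_bpErr_two_pow`). -/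
  A' : Language Bool
  /-- Query-length polynomial. -/
  ℓ : Polynomial ℕ
  /-- Coin polynomial of `A'`. -/
  qA : Polynomial ℕ

namespace RefuterKit

variable (κ : RefuterKit)

/-! ### The pure model -/

/-- The query asked about the prefix `z` at input length `n`: the padded image, of length `ℓ(n)`,
of `⟨1ⁿ, z⟩` under `f₁` (`b = true`) resp. `f₀` (`b = false`). [cite: ChenEtAl2022, §5.1 (proof of Thm. 5.2)] -/
def qry (b : Bool) (n : ℕ) (z : List Bool) : List Bool :=
  κ.padS (boolPair ((if b then κ.f₁ else κ.f₀) (boolPair (ones n) z)) (ones (κ.ℓ.eval n)))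

/-- The coin-block length at input length `n`: `qA(ℓ(n))`. [folklore] -/
def K (n : ℕ) : ℕ := κ.qA.eval (κ.ℓ.eval n)

/-- The answer of the amplified algorithm on query `y` with coins `c`: `[⟨y, c⟩ ∈ A']`. [folklore] -/
noncomputable def ans (y c : List Bool) : Bool := (κ.A').boolIndicator (boolPair y c)

/-- The `G`-bit of the prefix `z` computed from two coin blocks:
"`⟨1ⁿ, z⟩ ∈ G¹` or `⟨1ⁿ, z⟩ ∉ (G⁰)ᶜ`" as answered by the refuted algorithm on the two reduced
queries. [cite: ChenEtAl2022, §5.1 (proof of Thm. 5.2: "`R^A`")] -/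
noncomputable def gbit (n : ℕ) (z c c' : List Bool) : Bool :=
  κ.ans (κ.qry true n z) c || ! κ.ans (κ.qry false n z) c'

/-- The `j`-th coin block of length `K` of a coin string. [folklore] -/
def block (K j : ℕ) (r : List Bool) : List Bool := (r.drop (j * K)).take K

/-- **One round of the prefix search** on the state `(stopped?, prefix x, remaining coins)`:
consume four coin blocks; unless stopped, extend `x` by `0` if the `G`-bit of `x0` is set, else by
`1` if the `G`-bit of `x1` is set, else stop. [cite: ChenEtAl2022, §5.1 (Algorithm 1)] -/
noncomputable def pureStep (n : ℕ) (s : Bool × List Bool × List Bool) : Bool × List Bool × List Bool :=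
  let rr := s.2.2
  let rr' := rr.drop (4 * κ.K n)
  if s.1 then (true, s.2.1, rr')
  else if κ.gbit n (s.2.1 ++ [false]) (block (κ.K n) 0 rr) (block (κ.K n) 1 rr) then (false, s.2.1 ++ [false], rr')
  else if κ.gbit n (s.2.1 ++ [true]) (block (κ.K n) 2 rr) (block (κ.K n) 3 rr) then (false, s.2.1 ++ [true], rr')
  else (true, s.2.1, rr')

/-- The `G`-bit with the TRUE answers `[q ∈ A]` (the canonical run). [cite: ChenEtAl2022, §5.1 (proof of Thm. 5.2)] -/
noncomputable def cbit (A : Language Bool) (n : ℕ) (z : List Bool) : Bool :=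
  A.boolIndicator (κ.qry true n z) || ! A.boolIndicator (κ.qry false n z)

/-- **One round of the canonical prefix search** (state `(stopped?, prefix)`).
[cite: ChenEtAl2022, §5.1 (Algorithm 1)] -/
noncomputable def canonStep (A : Language Bool) (n : ℕ) (s : Bool × List Bool) : Bool × List Bool :=
  if s.1 then s
  else if κ.cbit A n (s.2 ++ [false]) then (false, s.2 ++ [false])
  else if κ.cbit A n (s.2 ++ [true]) then (false, s.2 ++ [true])
  else (true, s.2)

/-- The canonical state after `k` rounds. [cite: ChenEtAl2022, §5.1 (Algorithm 1)] -/
noncomputable def canon (A : Language Bool) (n k : ℕ) : Bool × List Bool := (κ.canonStep A n)^[k] (false, [])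

/-- The canonical `t`-th query, `t = 4k + j`: at the canonical prefix `x_k`, the queries for
`x_k 0` (`j = 0, 1`: under `f₁`, `f₀`) and for `x_k 1` (`j = 2, 3`). [cite: ChenEtAl2022, §5.1 (proof of Thm. 5.2)] -/
noncomputable def cqry (A : Language Bool) (n t : ℕ) : List Bool :=
  κ.qry (decide (t % 2 = 0)) n ((κ.canon A n (t / 4)).2 ++ [decide (2 ≤ t % 4)])

/-- **Good coins**: every one of the `4n` blocks answers its canonical query correctly.
[cite: ChenEtAl2022, §5.1 (proof of Thm. 5.2, case `𝒞 = BPP`)] -/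
def Good (A : Language Bool) (n : ℕ) (r : List Bool) : Prop :=
  ∀ t < 4 * n, κ.ans (κ.cqry A n t) (block (κ.K n) t r) = A.boolIndicator (κ.cqry A n t)

/-! ### The coupling lemma -/

/-- Blocks of a dropped string. [folklore] -/
theorem block_drop (K a j : ℕ) (r : List Bool) : block K j (r.drop (a * K)) = block K (a + j) r := by
  simp only [block, List.drop_drop]
  congr 2
  ring

/-- The canonical queries of round `k`, by their offset `j < 4`. [folklore] -/
theorem cqry_eq (A : Language Bool) (n k j : ℕ) (hj : j < 4) :
    κ.cqry A n (4 * k + j) = κ.qry (decide (j % 2 = 0)) n ((κ.canon A n k).2 ++ [decide (2 ≤ j)]) := by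
  have h1 : (4 * k + j) / 4 = k := by omega
  have h2 : (4 * k + j) % 4 = j := by omega
  have h3 : (4 * k + j) % 2 = j % 2 := by omega
  simp only [cqry, h1, h2, h3]

/-- With good coins the `G`-bit of round `k < n` at the canonical prefix is the canonical `G`-bit.
[cite: ChenEtAl2022, §5.1 (proof of Thm. 5.2)] -/
theorem gbit_eq_cbit_of_good {A : Language Bool} {n : ℕ} {r : List Bool} (hr : κ.Good A n r) {k : ℕ}
    (hk : k < n) (b : Bool) :
    κ.gbit n ((κ.canon A n k).2 ++ [b]) (block (κ.K n) (4 * k + 2 * b.toNat) r)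
        (block (κ.K n) (4 * k + (2 * b.toNat + 1)) r) =
      κ.cbit A n ((κ.canon A n k).2 ++ [b]) := by
  have h1 := hr (4 * k + 2 * b.toNat) (by cases b <;> simp only [Bool.toNat_false, Bool.toNat_true] <;> omega)
  have h2 := hr (4 * k + (2 * b.toNat + 1)) (by cases b <;> simp only [Bool.toNat_false, Bool.toNat_true] <;> omega)
  have e1 : κ.cqry A n (4 * k + 2 * b.toNat) = κ.qry true n ((κ.canon A n k).2 ++ [b]) := by
    rw [κ.cqry_eq A n k _ (by cases b <;> simp)]
    cases b <;> rfl
  have e2 : κ.cqry A n (4 * k + (2 * b.toNat + 1)) = κ.qry false n ((κ.canon A n k).2 ++ [b]) := by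
    rw [κ.cqry_eq A n k _ (by cases b <;> simp)]
    cases b <;> rfl
  rw [e1] at h1
  rw [e2] at h2
  simp only [gbit, h1, h2, cbit]

/-- **Coupling**: with good coins, the first `k ≤ n` rounds of the run are the canonical rounds,
and `4k` blocks have been consumed. [cite: ChenEtAl2022, §5.1 (proof of Thm. 5.2: "`A'(·, r)` decides
the same language as `A` … we may apply the same proof")] -/
theorem iterate_pureStep_eq_canon {A : Language Bool} {n : ℕ} {r : List Bool} (hr : κ.Good A n r) :
    ∀ k ≤ n, (κ.pureStep n)^[k] (false, [], r) =
      ((κ.canon A n k).1, (κ.canon A n k).2, r.drop (4 * k * κ.K n)) := by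
  intro k hk
  induction k with
  | zero => simp [canon]
  | succ k ih =>
    have hk' : k < n := by omega
    rw [Function.iterate_succ_apply', ih hk'.le]
    have hc : κ.canon A n (k + 1) = κ.canonStep A n (κ.canon A n k) := by
      simp only [canon, Function.iterate_succ_apply']
    rw [hc]
    have hd : 4 * (k + 1) * κ.K n = 4 * k * κ.K n + 4 * κ.K n := by ring
    rw [hd, ← List.drop_drop]
    set x := (κ.canon A n k).2 with hx
    set r' := r.drop (4 * k * κ.K n) with hr'
    have hb : ∀ j, block (κ.K n) j r' = block (κ.K n) (4 * k + j) r := fun j => by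
      rw [hr', block_drop]
    have g0 := κ.gbit_eq_cbit_of_good hr hk' false
    have g1 := κ.gbit_eq_cbit_of_good hr hk' true
    simp only [Bool.toNat_false, Bool.toNat_true, mul_zero, add_zero, mul_one, Nat.reduceAdd, ← hx] at g0 g1
    cases hf : (κ.canon A n k).1
    · -- running
      show κ.pureStep n (false, x, r') = _
      simp only [pureStep, canonStep, hf, hb, Nat.add_zero, g0, g1, Bool.false_eq_true, if_false]
      split_ifs <;> rfl
    · -- stopped
      show κ.pureStep n (true, x, r') = _
      simp only [pureStep, canonStep, hf, if_true, hx]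

/-! ### The union bound over the `4n` coin blocks -/

/-- The bad coin blocks for a query `y`: those on which the amplified algorithm errs about `A`.
[cite: AroraBarak2009, Thm. 7.10] -/
def badCoins (A : Language Bool) (y : List Bool) : Set (List Bool) :=
  {c | ¬ (boolPair y c ∈ κ.A' ↔ y ∈ A)}

/-- A block answers `y` correctly iff it is not bad. [folklore] -/
theorem ans_eq_iff_not_mem_badCoins (A : Language Bool) (y c : List Bool) :
    κ.ans y c = A.boolIndicator y ↔ c ∉ κ.badCoins A y := by
  simp only [ans, badCoins, Set.mem_setOf_eq, not_not]
  by_cases h1 : boolPair y c ∈ κ.A' <;> by_cases h2 : y ∈ A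
  · rw [(Set.mem_iff_boolIndicator _ _).1 h1, (Set.mem_iff_boolIndicator _ _).1 h2]
    exact ⟨fun _ => ⟨fun _ => h2, fun _ => h1⟩, fun _ => rfl⟩
  · rw [(Set.mem_iff_boolIndicator _ _).1 h1, (Set.notMem_iff_boolIndicator _ _).1 h2]
    exact ⟨fun h => absurd h (by decide), fun h => absurd (h.1 h1) h2⟩
  · rw [(Set.notMem_iff_boolIndicator _ _).1 h1, (Set.mem_iff_boolIndicator _ _).1 h2]
    exact ⟨fun h => absurd h (by decide), fun h => absurd (h.2 h2) h1⟩
  · rw [(Set.notMem_iff_boolIndicator _ _).1 h1, (Set.notMem_iff_boolIndicator _ _).1 h2]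
    exact ⟨fun _ => ⟨fun h => absurd h h1, fun h => absurd h h2⟩, fun _ => rfl⟩

/-- **Union bound**: if every query of length `ℓ(n)` is answered wrongly by a fraction `≤ 2^{-ℓ(n)}`
of its `K(n) = qA(ℓ(n))` coin blocks, then coin strings of any length `M ≥ 4n·K(n)` are bad with
probability `≤ 4n · 2^{-ℓ(n)}` (`uniformProb_exists_badBlock_le`).
[cite: ChenEtAl2022, §5.1 (proof of Thm. 5.2, case `𝒞 = BPP`)] [cite: AroraBarak2009, §7.4.1] -/
theorem uniformProb_not_good_le (A : Language Bool) (n : ℕ)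
    (hlen : ∀ t < 4 * n, (κ.cqry A n t).length = κ.ℓ.eval n)
    (hamp : ∀ y : List Bool, y.length = κ.ℓ.eval n →
      uniformProb (κ.qA.eval y.length) (κ.badCoins A y) ≤ 1 / 2 ^ (κ.ℓ.eval n))
    {M : ℕ} (hM : 4 * n * κ.K n ≤ M) :
    uniformProb M {r | ¬ κ.Good A n r} ≤ 4 * n * (1 / 2 ^ (κ.ℓ.eval n)) := by
  have hset : {r : List Bool | ¬ κ.Good A n r} =
      {r | ∃ t < 4 * n, (r.drop (t * κ.K n)).take (κ.K n) ∈ κ.badCoins A (κ.cqry A n t)} := by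
    ext r
    simp only [Good, Set.mem_setOf_eq, not_forall, exists_prop]
    refine exists_congr fun t => and_congr_right fun _ => ?_
    rw [ans_eq_iff_not_mem_badCoins, not_not]
    rfl
  rw [hset]
  have h := uniformProb_exists_badBlock_le (ℓ := κ.K n) (Q := 4 * n) (m := M) hM
    (fun t _ => κ.badCoins A (κ.cqry A n t)) (δ := 1 / 2 ^ (κ.ℓ.eval n)) (fun t ht w _ => by
      have h1 := hamp (κ.cqry A n t) (hlen t ht)
      rwa [hlen t ht] at h1)
  exact_mod_cast h

/-! ### Invariants of the canonical run -/

section Canon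

variable (A : Language Bool) (n : ℕ)

/-- One more canonical round. [folklore] -/
theorem canon_succ (k : ℕ) : κ.canon A n (k + 1) = κ.canonStep A n (κ.canon A n k) := by
  simp only [canon, Function.iterate_succ_apply']

/-- **Invariants of the canonical prefix search** after `k` rounds, state `(stopped?, x)`:
while running `|x| = k`; once stopped `|x| < k` and both `G`-bits at `x0`, `x1` are `0`; and a
nonempty prefix was extended with `G`-bit `1`. [cite: ChenEtAl2022, §5.1 (proof of Thm. 5.2)] -/
theorem canon_inv (k : ℕ) :
    ((κ.canon A n k).1 = false → (κ.canon A n k).2.length = k) ∧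
    ((κ.canon A n k).1 = true → (κ.canon A n k).2.length < k ∧
        κ.cbit A n ((κ.canon A n k).2 ++ [false]) = false ∧ κ.cbit A n ((κ.canon A n k).2 ++ [true]) = false) ∧
    ((κ.canon A n k).2 ≠ [] → κ.cbit A n (κ.canon A n k).2 = true) := by
  induction k with
  | zero => simp [canon]
  | succ k ih =>
    obtain ⟨ih1, ih2, ih3⟩ := ih
    rw [canon_succ]
    set s := κ.canon A n k with hs
    cases hf : s.1
    · have hlen := ih1 hf
      by_cases h0 : κ.cbit A n (s.2 ++ [false]) = true
      · have e : κ.canonStep A n s = (false, s.2 ++ [false]) := by simp [canonStep, hf, h0]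
        rw [e]
        exact ⟨fun _ => by simp [hlen], fun h => absurd h (by simp), fun _ => h0⟩
      · by_cases h1 : κ.cbit A n (s.2 ++ [true]) = true
        · have e : κ.canonStep A n s = (false, s.2 ++ [true]) := by simp [canonStep, hf, h0, h1]
          rw [e]
          exact ⟨fun _ => by simp [hlen], fun h => absurd h (by simp), fun _ => h1⟩
        · have e : κ.canonStep A n s = (true, s.2) := by simp [canonStep, hf, h0, h1]
          rw [e]
          refine ⟨fun h => absurd h (by simp), fun _ => ⟨by simp only; omega, ?_, ?_⟩, ih3⟩
          · simpa using h0
          · simpa using h1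
    · obtain ⟨hlt, hb0, hb1⟩ := ih2 hf
      have e : κ.canonStep A n s = s := by simp [canonStep, hf]
      rw [e]
      exact ⟨fun h => absurd (hf.symm.trans h) (by simp), fun _ => ⟨by omega, hb0, hb1⟩, ih3⟩

end Canon

/-! ### The combinatorial heart: some list entry is a counterexample -/

section Heart

variable {L A : Language Bool} {n : ℕ}

/-- "Some `y ∈ {0,1}ⁿ` extending `z` is an input on which `A` errs about `L`." [cite: ChenEtAl2022, §5.1 (the language `G_A`)] -/
def Err (L A : Language Bool) (n : ℕ) (z : List Bool) : Prop :=
  ∃ y : List Bool, y.length = n ∧ z <+: y ∧ ¬ (y ∈ L ↔ y ∈ A)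

/-- **`R^A` decides `G_A` where `A` is correct on the two queries**: if `A` agrees with `L` on
`qry true n z` and on `qry false n z`, then the canonical `G`-bit of `z` is `[Err z]`.
[cite: ChenEtAl2022, §5.1 (proof of Thm. 5.2: "either `R^A` solves `G_A(1ⁿ, x)` correctly, or `A`
gives the incorrect answer on at least one of the queries")] -/
theorem cbit_eq_true_iff {z : List Bool}
    (hq1 : κ.qry true n z ∈ L ↔ ∃ y : List Bool, y.length = n ∧ z <+: y ∧ y ∈ L ∧ y ∉ A)
    (hq0 : κ.qry false n z ∈ L ↔ ∀ y : List Bool, y.length = n → z <+: y → (y ∈ L ∨ y ∉ A))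
    (hc1 : κ.qry true n z ∈ L ↔ κ.qry true n z ∈ A) (hc0 : κ.qry false n z ∈ L ↔ κ.qry false n z ∈ A) :
    κ.cbit A n z = true ↔ Err L A n z := by
  classical
  have e1 : A.boolIndicator (κ.qry true n z) = true ↔ κ.qry true n z ∈ A :=
    (Set.mem_iff_boolIndicator _ _).symm
  have e0 : A.boolIndicator (κ.qry false n z) = true ↔ κ.qry false n z ∈ A :=
    (Set.mem_iff_boolIndicator _ _).symm
  rw [cbit, Bool.or_eq_true, e1, Bool.not_eq_true', ← Bool.not_eq_true, e0, ← hc1, ← hc0, hq1, hq0]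
  constructor
  · rintro (⟨y, hy, hzy, hyL, hyA⟩ | h)
    · exact ⟨y, hy, hzy, fun h => hyA (h.1 hyL)⟩
    · push Not at h
      obtain ⟨y, hy, hzy, hyL, hyA⟩ := h
      exact ⟨y, hy, hzy, fun h => hyL (h.2 hyA)⟩
  · rintro ⟨y, hy, hzy, hne⟩
    by_cases hyL : y ∈ L
    · exact Or.inl ⟨y, hy, hzy, hyL, fun hyA => hne ⟨fun _ => hyA, fun _ => hyL⟩⟩
    · right
      intro h
      rcases h y hy hzy with h' | h'
      · exact hyL h'
      · exact hne ⟨fun h'' => absurd h'' hyL, fun h'' => absurd h'' h'⟩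

/-- An error extending `z` strictly extends `z0` or `z1`. [folklore] -/
theorem err_append_of_err {z : List Bool} (hz : z.length < n) (h : Err L A n z) :
    Err L A n (z ++ [false]) ∨ Err L A n (z ++ [true]) := by
  obtain ⟨y, hy, ⟨d, rfl⟩, hne⟩ := h
  cases d with
  | nil => simp at hy; omega
  | cons b d =>
    have : z ++ [b] <+: z ++ b :: d := ⟨d, by simp⟩
    cases b
    · exact Or.inl ⟨_, hy, this, hne⟩
    · exact Or.inr ⟨_, hy, this, hne⟩

/-- The seven entries of the canonical list at the final prefix `x`: `x` itself and the six
queries at `x`, `x0`, `x1`. [cite: ChenEtAl2022, §5.1 (proof of Thm. 5.2: "the list contains at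
most six strings, each of which has length `n` or `ℓ(n)`" — plus `x`)] -/
def slotVal (n : ℕ) (x : List Bool) : Fin 7 → List Bool
  | 0 => x
  | 1 => κ.qry true n x
  | 2 => κ.qry false n x
  | 3 => κ.qry true n (x ++ [false])
  | 4 => κ.qry false n (x ++ [false])
  | 5 => κ.qry true n (x ++ [true])
  | 6 => κ.qry false n (x ++ [true])

/-- **The combinatorial heart** (Chen–Jin–Santhanam–Williams 2022, proof of Thm. 5.2, the three
cases `|x| = 0`, `1 ≤ |x| < n`, `|x| = n`): if `A` errs about `L` on some input of length `n`, and
the two reductions are correct on prefixes of length `≤ n` (`hq1`, `hq0`), then `A` errs on one of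
the seven entries of the canonical list — and if it is the final prefix itself, that prefix has
length `n`. [cite: ChenEtAl2022, §5.1 (proof of Thm. 5.2)] -/
theorem exists_slot_error (hbad : ∃ y : List Bool, y.length = n ∧ ¬ (y ∈ L ↔ y ∈ A))
    (hq1 : ∀ z : List Bool, z.length ≤ n →
      (κ.qry true n z ∈ L ↔ ∃ y : List Bool, y.length = n ∧ z <+: y ∧ y ∈ L ∧ y ∉ A))
    (hq0 : ∀ z : List Bool, z.length ≤ n →
      (κ.qry false n z ∈ L ↔ ∀ y : List Bool, y.length = n → z <+: y → (y ∈ L ∨ y ∉ A))) :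
    ∃ i : Fin 7, ¬ (κ.slotVal n (κ.canon A n n).2 i ∈ L ↔ κ.slotVal n (κ.canon A n n).2 i ∈ A) ∧
      (i = 0 → (κ.canon A n n).2.length = n) := by
  classical
  by_contra hall
  simp only [not_exists, not_and] at hall
  -- `A` is correct on the six queries, and on `x` if `|x| = n`
  set x := (κ.canon A n n).2 with hx
  obtain ⟨hinv1, hinv2, hinv3⟩ := κ.canon_inv A n n
  have hxle : x.length ≤ n := by
    cases hf : (κ.canon A n n).1
    · exact (hinv1 hf).le
    · exact (hinv2 hf).1.le
  have hG : ∀ z : List Bool, z.length ≤ n →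
      (κ.qry true n z ∈ L ↔ κ.qry true n z ∈ A) → (κ.qry false n z ∈ L ↔ κ.qry false n z ∈ A) →
      (κ.cbit A n z = true ↔ Err L A n z) := fun z hz h1 h0 =>
    κ.cbit_eq_true_iff (hq1 z hz) (hq0 z hz) h1 h0
  have hne0 : ∀ i : Fin 7, i ≠ 0 → (κ.slotVal n x i ∈ L ↔ κ.slotVal n x i ∈ A) := fun i hi => by
    by_contra h
    exact hall i h (fun h' => absurd h' hi)
  have c1 : κ.qry true n x ∈ L ↔ κ.qry true n x ∈ A := hne0 1 (by decide)
  have c2 : κ.qry false n x ∈ L ↔ κ.qry false n x ∈ A := hne0 2 (by decide)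
  have c3 : κ.qry true n (x ++ [false]) ∈ L ↔ κ.qry true n (x ++ [false]) ∈ A := hne0 3 (by decide)
  have c4 : κ.qry false n (x ++ [false]) ∈ L ↔ κ.qry false n (x ++ [false]) ∈ A := hne0 4 (by decide)
  have c5 : κ.qry true n (x ++ [true]) ∈ L ↔ κ.qry true n (x ++ [true]) ∈ A := hne0 5 (by decide)
  have c6 : κ.qry false n (x ++ [true]) ∈ L ↔ κ.qry false n (x ++ [true]) ∈ A := hne0 6 (by decide)
  -- `Err x` holds in every case
  have hErrx : Err L A n x := by
    by_cases hxn : x = []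
    · obtain ⟨y, hy, hne⟩ := hbad
      exact ⟨y, hy, by rw [hxn]; exact List.nil_prefix, hne⟩
    · exact (hG x hxle c1 c2).1 (hinv3 hxn)
  cases hf : (κ.canon A n n).1
  · -- never stopped: `|x| = n`, so `x` itself is the error, and it was excluded
    have hlen : x.length = n := hinv1 hf
    obtain ⟨y, hy, hxy, hne⟩ := hErrx
    have hyx : y = x := (hxy.eq_of_length (by omega)).symm
    rw [hyx] at hne
    exact hall 0 hne (fun _ => hlen)
  · -- stopped with `|x| < n`: the `G`-bits at `x0`, `x1` are `0`, but one of them errs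
    obtain ⟨hlt, hb0, hb1⟩ := hinv2 hf
    rcases err_append_of_err hlt hErrx with h | h
    · have := (hG _ (by simp; omega) c3 c4).2 h
      rw [hb0] at this
      exact Bool.false_ne_true this
    · have := (hG _ (by simp; omega) c5 c6).2 h
      rw [hb1] at this
      exact Bool.false_ne_true this

end Heart

/-! ### The brick realisation of one round

Records `z = ⟨v, ⟨counter, ⟨flag, ⟨x, coins left⟩⟩⟩⟩` with `v = ⟨1ⁿ, r⟩` the input of the refuter
(`Brick.loopStep` layout); the state `(stopped?, x, rr)` is coded `⟨flag, ⟨x, rr⟩⟩` with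
`flag = [1]` for stopped and `flag = ε` for running. -/

noncomputable section Bricks

/-- The code of a state of the prefix search. [folklore] -/
def enc (s : Bool × List Bool × List Bool) : List Bool :=
  boolPair (if s.1 then [true] else []) (boolPair s.2.1 s.2.2)

/-- The record of a round: input `⟨1ⁿ, r⟩`, counter, coded state. [folklore] -/
def zOf (n : ℕ) (r cnt : List Bool) (s : Bool × List Bool × List Bool) : List Bool :=
  boolPair (boolPair (ones n) r) (boolPair cnt (enc s))

/-- `1ⁿ` off the record. [folklore] -/
def uF : List Bool → List Bool := fstF ∘ fstF
/-- The flag field. [folklore] -/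
def flagF : List Bool → List Bool := nthF 2
/-- The prefix field. [folklore] -/
def xF : List Bool → List Bool := nthF 3
/-- The remaining coins. [folklore] -/
def rrF : List Bool → List Bool := sndPow 3

/-- The block ruler `1^{K(n)}`. [folklore] -/
def kRul : List Bool → List Bool := polyFn (κ.qA.comp κ.ℓ) ∘ uF
/-- The query-length ruler `1^{ℓ(n)}`. [folklore] -/
def lRul : List Bool → List Bool := polyFn κ.ℓ ∘ uF

/-- The remaining coins after `j` blocks. [folklore] -/
def rrDrop : ℕ → (List Bool → List Bool)
  | 0 => rrF
  | j + 1 => dropFn ∘ fanoutFn κ.kRul (rrDrop j)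

/-- The `j`-th coin block. [folklore] -/
def blkF (j : ℕ) : List Bool → List Bool := takeFn ∘ fanoutFn κ.kRul (κ.rrDrop j)

/-- Appending one bit. [folklore] -/
def appF (b : Bool) : List Bool → List Bool := fun w => w ++ [b]

/-- The query brick: `z ↦ padS ⟨f_b ⟨1ⁿ, Z z⟩, 1^{ℓ(n)}⟩`. [cite: ChenEtAl2022, §5.1 (proof of Thm. 5.2)] -/
def qryF (b : Bool) (Z : List Bool → List Bool) : List Bool → List Bool :=
  κ.padS ∘ fanoutFn ((if b then κ.f₁ else κ.f₀) ∘ fanoutFn uF Z) κ.lRul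

/-- The one-symbol indicator of `A'`. [folklore] -/
def indF : List Bool → List Bool := fun w => encodeBool ((κ.A').boolIndicator w)

/-- The answer brick `z ↦ [⟨Y z, C z⟩ ∈ A']`. [folklore] -/
def ansF (Y C : List Bool → List Bool) : List Bool → List Bool := κ.indF ∘ fanoutFn Y C

/-- `a ∨ ¬ b` on one-bit bricks. [folklore] -/
def orNotF (a b : List Bool → List Bool) : List Bool → List Bool := iteFn a (fun _ => [true]) (notFn b)

/-- The `G`-bit brick of `x b` from the blocks `j`, `j + 1`. [cite: ChenEtAl2022, §5.1 (proof of Thm. 5.2)] -/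
def gF (b : Bool) (j : ℕ) : List Bool → List Bool :=
  orNotF (κ.ansF (κ.qryF true (appF b ∘ xF)) (κ.blkF j)) (κ.ansF (κ.qryF false (appF b ∘ xF)) (κ.blkF (j + 1)))

/-- A new state with flag `fl`, prefix `X z` and four blocks consumed. [folklore] -/
def stF (fl : List Bool) (X : List Bool → List Bool) : List Bool → List Bool :=
  fanoutFn (fun _ => fl) (fanoutFn X (κ.rrDrop 4))

/-- **The round brick** (the body of the counted loop): `pureStep` on coded states.
[cite: ChenEtAl2022, §5.1 (Algorithm 1)] -/
def body : List Bool → List Bool :=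
  iteFn (isNilFn ∘ flagF)
    (iteFn (κ.gF false 0) (κ.stF [] (appF false ∘ xF))
      (iteFn (κ.gF true 2) (κ.stF [] (appF true ∘ xF)) (κ.stF [true] xF)))
    (κ.stF [true] xF)

/-! #### Values on records -/

variable (n : ℕ) (r cnt : List Bool) (s : Bool × List Bool × List Bool)

/-- `uF` reads `1ⁿ` off a record. [folklore] -/
@[simp] theorem uF_zOf : uF (zOf n r cnt s) = ones n := by simp [uF, zOf]
/-- `flagF` reads the flag off a record. [folklore] -/
@[simp] theorem flagF_zOf : flagF (zOf n r cnt s) = (if s.1 then [true] else []) := by simp [flagF, zOf, enc]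
/-- `xF` reads the prefix off a record. [folklore] -/
@[simp] theorem xF_zOf : xF (zOf n r cnt s) = s.2.1 := by simp [xF, zOf, enc]
/-- `rrF` reads the remaining coins off a record. [folklore] -/
@[simp] theorem rrF_zOf : rrF (zOf n r cnt s) = s.2.2 := by simp [rrF, zOf, enc]
/-- `kRul` gives the block ruler `1^{K(n)}` on a record. [folklore] -/
@[simp] theorem kRul_zOf : κ.kRul (zOf n r cnt s) = ones (κ.K n) := by
  simp [kRul, K, Polynomial.eval_comp]
/-- `lRul` gives the query-length ruler `1^{ℓ(n)}` on a record. [folklore] -/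
@[simp] theorem lRul_zOf : κ.lRul (zOf n r cnt s) = ones (κ.ℓ.eval n) := by simp [lRul]

/-- `rrDrop j` drops `j` blocks of the remaining coins of a record. [folklore] -/
@[simp] theorem rrDrop_zOf (j : ℕ) : κ.rrDrop j (zOf n r cnt s) = s.2.2.drop (j * κ.K n) := by
  induction j with
  | zero => simp [rrDrop]
  | succ j ih =>
    simp only [rrDrop, Function.comp_apply, fanoutFn_apply, ih, kRul_zOf, dropFn_boolPair, List.length_replicate,
      List.drop_drop]
    congr 1
    ring

/-- `blkF j` gives the `j`-th coin block of a record. [folklore] -/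
@[simp] theorem blkF_zOf (j : ℕ) : κ.blkF j (zOf n r cnt s) = block (κ.K n) j s.2.2 := by
  simp [blkF, fanoutFn_apply, block]

/-- `qryF b Z` computes the query `qry b n (Z z)` on a record. [folklore] -/
@[simp] theorem qryF_zOf (b : Bool) (Z : List Bool → List Bool) :
    κ.qryF b Z (zOf n r cnt s) = κ.qry b n (Z (zOf n r cnt s)) := by
  simp only [qryF, qry, Function.comp_apply, fanoutFn_apply, uF_zOf, lRul_zOf]

/-- `ansF Y C` is the one-bit answer `[ans (Y z) (C z)]`. [folklore] -/
@[simp] theorem ansF_apply (Y C : List Bool → List Bool) (z : List Bool) :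
    κ.ansF Y C z = [κ.ans (Y z) (C z)] := by
  simp only [ansF, indF, ans, Function.comp_apply, fanoutFn_apply]
  rfl

/-- `ansF Y C` is one-bit. [folklore] -/
theorem oneBit_ansF (Y C : List Bool → List Bool) : OneBit (κ.ansF Y C) := fun z => ⟨_, κ.ansF_apply Y C z⟩

/-- `orNotF a b` computes `a ∨ ¬ b` on one-bit bricks. [folklore] -/
theorem orNotF_apply {a b : List Bool → List Bool} {z : List Bool} {α β : Bool} (ha : a z = [α]) (hb : b z = [β]) :
    orNotF a b z = [α || !β] := by
  rw [orNotF, iteFn_apply ha, notFn_apply hb]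
  cases α <;> rfl

/-- `orNotF` of one-bit bricks is one-bit. [folklore] -/
theorem oneBit_orNotF {a b : List Bool → List Bool} (ha : OneBit a) (hb : OneBit b) : OneBit (orNotF a b) :=
  ha.ite (oneBit_const true) (oneBit_notFn hb)

/-- `gF b j` computes the `G`-bit of `x b` from blocks `j`, `j + 1` on a record. [folklore] -/
@[simp] theorem gF_zOf (b : Bool) (j : ℕ) :
    κ.gF b j (zOf n r cnt s) = [κ.gbit n (s.2.1 ++ [b]) (block (κ.K n) j s.2.2) (block (κ.K n) (j + 1) s.2.2)] := by
  rw [gF, orNotF_apply (κ.ansF_apply _ _ _) (κ.ansF_apply _ _ _)]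
  simp [gbit, appF]

/-- `gF b j` is one-bit. [folklore] -/
theorem oneBit_gF (b : Bool) (j : ℕ) : OneBit (κ.gF b j) := oneBit_orNotF (κ.oneBit_ansF _ _) (κ.oneBit_ansF _ _)

/-- Value of the new-state brick `stF`. [folklore] -/
theorem stF_apply (fl : List Bool) (X : List Bool → List Bool) (z : List Bool) :
    κ.stF fl X z = boolPair fl (boolPair (X z) (κ.rrDrop 4 z)) := by
  simp only [stF, fanoutFn_apply]

/-- **The round brick computes `pureStep` on coded states.** [cite: ChenEtAl2022, §5.1 (Algorithm 1)] -/
theorem body_zOf : κ.body (zOf n r cnt s) = enc (κ.pureStep n s) := by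
  have hflag : (isNilFn ∘ flagF) (zOf n r cnt s) = [!s.1] := by
    simp only [Function.comp_apply, flagF_zOf, isNilFn]
    cases s.1 <;> simp
  rw [body, iteFn_apply hflag]
  cases h1 : s.1
  · simp only [Bool.not_false, if_true]
    rw [iteFn_apply (κ.gF_zOf n r cnt s false 0)]
    split_ifs with g0
    · rw [stF_apply]
      simp [pureStep, h1, g0, enc, appF]
    · rw [iteFn_apply (κ.gF_zOf n r cnt s true 2)]
      split_ifs with g2
      · rw [stF_apply]
        simp [pureStep, h1, g0, g2, enc, appF]
      · rw [stF_apply]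
        simp [pureStep, h1, g0, g2, enc]
  · simp only [Bool.not_true, Bool.false_eq_true, if_false]
    rw [stF_apply]
    simp [pureStep, h1, enc]

/-! #### Membership in `FP` -/

variable {κ}
variable (hf₁ : κ.f₁ ∈ FP) (hf₀ : κ.f₀ ∈ FP) (hpad : κ.padS ∈ FP) (hA' : κ.A' ∈ Classes.P)

/-- `uF ∈ FP`. [folklore] -/
theorem uF_mem_FP : uF ∈ FP := comp_mem_FP fstF_mem_FP fstF_mem_FP
/-- `flagF ∈ FP`. [folklore] -/
theorem flagF_mem_FP : flagF ∈ FP := nthF_mem_FP 2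
/-- `xF ∈ FP`. [folklore] -/
theorem xF_mem_FP : xF ∈ FP := nthF_mem_FP 3
/-- `rrF ∈ FP`. [folklore] -/
theorem rrF_mem_FP : rrF ∈ FP := sndPow_mem_FP 3
/-- `kRul ∈ FP`. [folklore] -/
theorem kRul_mem_FP : κ.kRul ∈ FP := comp_mem_FP (polyFn_mem_FP _) uF_mem_FP
/-- `lRul ∈ FP`. [folklore] -/
theorem lRul_mem_FP : κ.lRul ∈ FP := comp_mem_FP (polyFn_mem_FP _) uF_mem_FP

/-- `rrDrop j ∈ FP`. [folklore] -/
theorem rrDrop_mem_FP : ∀ j, κ.rrDrop j ∈ FP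
  | 0 => rrF_mem_FP
  | j + 1 => comp_mem_FP dropFn_mem_FP (fanoutFn_mem_FP kRul_mem_FP (rrDrop_mem_FP j))

/-- `blkF j ∈ FP`. [folklore] -/
theorem blkF_mem_FP (j : ℕ) : κ.blkF j ∈ FP :=
  comp_mem_FP takeFn_mem_FP (fanoutFn_mem_FP kRul_mem_FP (rrDrop_mem_FP j))

/-- `appF b ∈ FP`. [folklore] -/
theorem appF_mem_FP (b : Bool) : appF b ∈ FP := append_mem_FP OracleCompose.id_mem_FP (const_mem_FP [b])

include hf₁ hf₀ hpad in
/-- `qryF b Z ∈ FP` for `Z ∈ FP` (and `f₁, f₀, padS ∈ FP`). [folklore] -/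
theorem qryF_mem_FP (b : Bool) {Z : List Bool → List Bool} (hZ : Z ∈ FP) : κ.qryF b Z ∈ FP := by
  refine comp_mem_FP hpad (fanoutFn_mem_FP (comp_mem_FP ?_ (fanoutFn_mem_FP uF_mem_FP hZ)) lRul_mem_FP)
  cases b
  · exact hf₀
  · exact hf₁

include hA' in
/-- `indF ∈ FP` for `A' ∈ P`. [folklore] -/
theorem indF_mem_FP : κ.indF ∈ FP := indicatorFn_mem_FP hA'

include hA' in
/-- `ansF Y C ∈ FP`. [folklore] -/
theorem ansF_mem_FP {Y C : List Bool → List Bool} (hY : Y ∈ FP) (hC : C ∈ FP) : κ.ansF Y C ∈ FP :=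
  comp_mem_FP (indF_mem_FP hA') (fanoutFn_mem_FP hY hC)

/-- `orNotF a b ∈ FP`. [folklore] -/
theorem orNotF_mem_FP {a b : List Bool → List Bool} (ha : a ∈ FP) (hb : b ∈ FP) : orNotF a b ∈ FP :=
  iteFn_mem_FP ha (const_mem_FP _) (notFn_mem_FP hb)

include hf₁ hf₀ hpad hA' in
/-- `gF b j ∈ FP`. [folklore] -/
theorem gF_mem_FP (b : Bool) (j : ℕ) : κ.gF b j ∈ FP :=
  orNotF_mem_FP
    (ansF_mem_FP hA' (qryF_mem_FP hf₁ hf₀ hpad true (comp_mem_FP (appF_mem_FP b) xF_mem_FP)) (blkF_mem_FP j))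
    (ansF_mem_FP hA' (qryF_mem_FP hf₁ hf₀ hpad false (comp_mem_FP (appF_mem_FP b) xF_mem_FP)) (blkF_mem_FP (j + 1)))

/-- `stF fl X ∈ FP`. [folklore] -/
theorem stF_mem_FP (fl : List Bool) {X : List Bool → List Bool} (hX : X ∈ FP) : κ.stF fl X ∈ FP :=
  fanoutFn_mem_FP (const_mem_FP fl) (fanoutFn_mem_FP hX (rrDrop_mem_FP 4))

include hf₁ hf₀ hpad hA' in
/-- **The round brick is in `FP`.** [cite: AroraBarak2009, §1.3 (composition)] -/
theorem body_mem_FP : κ.body ∈ FP :=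
  iteFn_mem_FP (comp_mem_FP isNilFn_mem_FP flagF_mem_FP)
    (iteFn_mem_FP (gF_mem_FP hf₁ hf₀ hpad hA' false 0) (stF_mem_FP [] (comp_mem_FP (appF_mem_FP false) xF_mem_FP))
      (iteFn_mem_FP (gF_mem_FP hf₁ hf₀ hpad hA' true 2) (stF_mem_FP [] (comp_mem_FP (appF_mem_FP true) xF_mem_FP))
        (stF_mem_FP [true] xF_mem_FP)))
    (stF_mem_FP [true] xF_mem_FP)

variable (κ)

/-! #### Growth of one round -/

/-- Dropping blocks shortens the coins: `|rrDrop j z| ≤ |rrF z|` on every input. [folklore] -/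
theorem length_rrDrop_le (z : List Bool) : ∀ j, (κ.rrDrop j z).length ≤ (rrF z).length
  | 0 => le_rfl
  | j + 1 => by
    simp only [rrDrop, Function.comp_apply, fanoutFn_apply, dropFn_boolPair, List.length_drop]
    exact (Nat.sub_le _ _).trans (length_rrDrop_le z j)

/-- The new states are short: `|stF fl X z| ≤ |sndPow 1 z| + 8` when `|fl| ≤ 1`, `|X z| ≤ |xF z| + 1`.
[folklore] -/
theorem length_stF_le {fl : List Bool} (hfl : fl.length ≤ 1) {X : List Bool → List Bool} (z : List Bool)
    (hX : (X z).length ≤ (xF z).length + 1) : (κ.stF fl X z).length ≤ (sndPow 1 z).length + 8 := by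
  rw [stF_apply, length_boolPair, length_boolPair]
  have h1 : (κ.rrDrop 4 z).length ≤ (sndPow 3 z).length := κ.length_rrDrop_le z 4
  have h2 : 2 * (nthF 3 z).length + (sndPow 3 z).length ≤ (sndPow 2 z).length :=
    length_nthF_succ_add_sndPow_succ_le 2 z
  have h3 : 2 * (nthF 2 z).length + (sndPow 2 z).length ≤ (sndPow 1 z).length :=
    length_nthF_succ_add_sndPow_succ_le 1 z
  have hX' : (X z).length ≤ (nthF 3 z).length + 1 := hX
  omega

/-- **Growth of one round**: `|body z| ≤ |sndPow 1 z| + 8` on every input. [folklore] -/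
theorem length_body_le (z : List Bool) : (κ.body z).length ≤ (sndPow 1 z).length + (8 : Polynomial ℕ).eval (fstF z).length := by
  have h8 : (8 : Polynomial ℕ).eval (fstF z).length = 8 := by simp
  rw [h8]
  have hx0 : ∀ b, ((appF b ∘ xF) z).length ≤ (xF z).length + 1 := fun b => by simp [appF]
  have hx1 : (xF z).length ≤ (xF z).length + 1 := Nat.le_succ _
  rw [body, iteFn_of_oneBit (oneBit_isNilFn.comp _)]
  split_ifs
  · rw [iteFn_of_oneBit (κ.oneBit_gF false 0)]
    split_ifs
    · exact κ.length_stF_le (by simp) z (hx0 false)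
    · rw [iteFn_of_oneBit (κ.oneBit_gF true 2)]
      split_ifs
      · exact κ.length_stF_le (by simp) z (hx0 true)
      · exact κ.length_stF_le (by simp) z hx1
  · exact κ.length_stF_le (by simp) z hx1

end Bricks

/-! ### The list-refuter as an `FP` function; the seven refuters -/

noncomputable section Whole

variable (hf₁ : κ.f₁ ∈ FP) (hf₀ : κ.f₀ ∈ FP) (hpad : κ.padS ∈ FP) (hA' : κ.A' ∈ Classes.P)

/-- The initial record `⟨v, ⟨bin n, code of (running, ε, r)⟩⟩` from the input `v = ⟨1ⁿ, r⟩`. [folklore] -/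
def initF : List Bool → List Bool :=
  fanoutFn id (fanoutFn (lenBinF ∘ fstF) (fanoutFn (fun _ => []) (fanoutFn (fun _ => []) sndF)))

/-- Value of `initF` on `⟨1ⁿ, r⟩`. [folklore] -/
theorem initF_apply (n : ℕ) (r : List Bool) :
    initF (boolPair (ones n) r) = zOf n r (encodeNat n) (false, [], r) := by
  simp [initF, zOf, enc, fanoutFn_apply]

/-- `initF ∈ FP`. [folklore] -/
theorem initF_mem_FP : initF ∈ FP :=
  fanoutFn_mem_FP OracleCompose.id_mem_FP (fanoutFn_mem_FP (comp_mem_FP lenBinF_mem_FP fstF_mem_FP)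
    (fanoutFn_mem_FP (const_mem_FP _) (fanoutFn_mem_FP (const_mem_FP _) sndF_mem_FP)))

/-- **The counted loop of `|v|` rounds** (of which `n` are active). [cite: ChenEtAl2022, §5.1 (Algorithm 1)] -/
def loopF : List Bool → List Bool := fun z => (loopStep κ.body)^[(X : Polynomial ℕ).eval (fstF z).length] z

/-- The state after `n` rounds of the run on coins `r`. [folklore] -/
def finState (n : ℕ) (r : List Bool) : Bool × List Bool × List Bool := (κ.pureStep n)^[n] (false, [], r)

/-- The model of the counted loop with body `body` is the iteration of `pureStep` on coded states. [folklore] -/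
theorem loopModel_body (n : ℕ) (r : List Bool) : ∀ (k : ℕ) (s : Bool × List Bool × List Bool),
    loopModel κ.body (boolPair (ones n) r) k (enc s) = enc ((κ.pureStep n)^[k] s)
  | 0, s => rfl
  | k + 1, s => by
    rw [loopModel, Function.iterate_succ_apply]
    have h := κ.body_zOf n r (encodeNat (k + 1)) s
    rw [zOf] at h
    rw [h, loopModel_body n r k]

/-- **The loop on the initial record ends in the code of `finState`.** [folklore] -/
theorem loopF_initF (n : ℕ) (r : List Bool) :
    κ.loopF (initF (boolPair (ones n) r)) = zOf n r [] (κ.finState n r) := by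
  rw [initF_apply, loopF, zOf]
  have hN : n ≤ (X : Polynomial ℕ).eval (fstF (boolPair (boolPair (ones n) r)
      (boolPair (encodeNat n) (enc (false, [], r))))).length := by
    simp [length_boolPair]
    omega
  rw [iterate_loopStep κ.body _ n _ _ hN, κ.loopModel_body n r n]
  rfl

variable {κ} in
include hf₁ hf₀ hpad hA' in
/-- `loopF ∈ FP` (counted loop with a body of constant growth, `loopFn_mem_FP_of_poly`). [folklore] -/
theorem loopF_mem_FP : κ.loopF ∈ FP :=
  loopFn_mem_FP_of_poly (body_mem_FP hf₁ hf₀ hpad hA') 8 κ.length_body_le X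

/-- The seven output bricks (the entries of the list, Lemma 5.1). [cite: ChenEtAl2022, §5.1 (Lemma 5.1)] -/
def slotF : Fin 7 → (List Bool → List Bool)
  | 0 => xF
  | 1 => κ.qryF true xF
  | 2 => κ.qryF false xF
  | 3 => κ.qryF true (appF false ∘ xF)
  | 4 => κ.qryF false (appF false ∘ xF)
  | 5 => κ.qryF true (appF true ∘ xF)
  | 6 => κ.qryF false (appF true ∘ xF)

/-- `slotF i` reads entry `i` of the list off a record. [folklore] -/
theorem slotF_zOf (n : ℕ) (r cnt : List Bool) (s : Bool × List Bool × List Bool) (i : Fin 7) :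
    κ.slotF i (zOf n r cnt s) = κ.slotVal n s.2.1 i := by
  fin_cases i <;> simp [slotF, slotVal, appF]

variable {κ} in
include hf₁ hf₀ hpad in
/-- `slotF i ∈ FP`. [folklore] -/
theorem slotF_mem_FP (i : Fin 7) : κ.slotF i ∈ FP := by
  fin_cases i
  · exact xF_mem_FP
  · exact qryF_mem_FP hf₁ hf₀ hpad true xF_mem_FP
  · exact qryF_mem_FP hf₁ hf₀ hpad false xF_mem_FP
  · exact qryF_mem_FP hf₁ hf₀ hpad true (comp_mem_FP (appF_mem_FP false) xF_mem_FP)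
  · exact qryF_mem_FP hf₁ hf₀ hpad false (comp_mem_FP (appF_mem_FP false) xF_mem_FP)
  · exact qryF_mem_FP hf₁ hf₀ hpad true (comp_mem_FP (appF_mem_FP true) xF_mem_FP)
  · exact qryF_mem_FP hf₁ hf₀ hpad false (comp_mem_FP (appF_mem_FP true) xF_mem_FP)

/-- **The refuter function of slot `i`** with the input preparation `P` (mapping `⟨1ᵐ, r⟩` to
`⟨1ⁿ, r⟩`, `n` the length to be refuted): prepare, initialise, loop, output entry `i`.
[cite: ChenEtAl2022, §5.1 (Lemma 5.1: "`B^{(i)}` prints `x^{(i)}_n` on input `1^{ℓ^{(i)}(n)}`")] -/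
def refF (P : List Bool → List Bool) (i : Fin 7) : List Bool → List Bool := κ.slotF i ∘ κ.loopF ∘ initF ∘ P

/-- **Value of the refuter function**: entry `i` of the list at the final prefix of the run. [folklore] -/
theorem refF_apply {P : List Bool → List Bool} {v : List Bool} {n : ℕ} {r : List Bool}
    (hP : P v = boolPair (ones n) r) (i : Fin 7) :
    κ.refF P i v = κ.slotVal n (κ.finState n r).2.1 i := by
  simp only [refF, Function.comp_apply, hP, loopF_initF, slotF_zOf]

variable {κ} in
include hf₁ hf₀ hpad hA' in
/-- `refF P i ∈ FP` for `P ∈ FP`. [folklore] -/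
theorem refF_mem_FP {P : List Bool → List Bool} (hP : P ∈ FP) (i : Fin 7) : κ.refF P i ∈ FP :=
  comp_mem_FP (slotF_mem_FP hf₁ hf₀ hpad i) (comp_mem_FP (loopF_mem_FP hf₁ hf₀ hpad hA') (comp_mem_FP initF_mem_FP hP))

/-! #### Input preparation: the inverse of `ℓ(n) = (n + c₀)^{2^J}` on unary inputs -/

/-- `⌊√·⌋` on numerals. [folklore] -/
def sqrtF : List Bool → List Bool := fun w => encodeNat (Nat.sqrt (bitsToNat w))

/-- Iterating `sqrtF` on numerals iterates `⌊√·⌋`. [folklore] -/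
theorem sqrtF_iterate (J v : ℕ) : sqrtF^[J] (encodeNat v) = encodeNat (Nat.sqrt^[J] v) := by
  induction J generalizing v with
  | zero => rfl
  | succ J ih => rw [Function.iterate_succ_apply, Function.iterate_succ_apply, ← ih]; simp [sqrtF]

/-- Iterates of an `FP` function (a fixed number of times) are in `FP`. [folklore] -/
theorem iterate_mem_FP' {f : List Bool → List Bool} (hf : f ∈ FP) : ∀ J : ℕ, f^[J] ∈ FP
  | 0 => OracleCompose.id_mem_FP
  | J + 1 => by rw [Function.iterate_succ]; exact comp_mem_FP (iterate_mem_FP' hf J) hf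

/-- The inverse length map `linv J c₀ m = ⌊√·⌋^{J}(m) - c₀`. [folklore] -/
def linv (J c₀ m : ℕ) : ℕ := Nat.sqrt^[J] m - c₀

/-- `⌊√·⌋^{J}(m) ≤ m`. [folklore] -/
theorem iterate_sqrt_le (J m : ℕ) : Nat.sqrt^[J] m ≤ m := by
  induction J with
  | zero => exact le_rfl
  | succ J ih => rw [Function.iterate_succ_apply']; exact (Nat.sqrt_le_self _).trans ih

/-- `linv J c₀ m ≤ m`. [folklore] -/
theorem linv_le (J c₀ m : ℕ) : linv J c₀ m ≤ m := (Nat.sub_le _ _).trans (iterate_sqrt_le J m)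

/-- `⌊√·⌋^{J}(a^{2^J}) = a`. [folklore] -/
theorem iterate_sqrt_pow (J a : ℕ) : Nat.sqrt^[J] (a ^ 2 ^ J) = a := by
  induction J with
  | zero => simp
  | succ J ih =>
    rw [Function.iterate_succ_apply, pow_succ, pow_mul, Nat.sqrt_eq', ih]

/-- `linv` inverts `n ↦ (n + c₀)^{2^J}`. [folklore] -/
theorem linv_pow (J c₀ n : ℕ) : linv J c₀ ((n + c₀) ^ 2 ^ J) = n := by
  rw [linv, iterate_sqrt_pow, Nat.add_sub_cancel]

/-- `1ᵐ ↦ 1^{linv J c₀ m}` as a brick (numeral of `m`, `J` square roots, minus `c₀`, back to unary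
with the input as ruler). [folklore] -/
def nOfM (J c₀ : ℕ) : List Bool → List Bool :=
  binToUnaryFn ∘ fanoutFn id (subFn ∘ fanoutFn id (fun _ => encodeNat c₀) ∘ sqrtF^[J] ∘ lenBinF)

/-- Value of `nOfM` on `1ᵐ`. [folklore] -/
theorem nOfM_ones (J c₀ m : ℕ) : nOfM J c₀ (ones m) = ones (linv J c₀ m) := by
  simp only [nOfM, Function.comp_apply, fanoutFn_apply, lenBinF_apply, List.length_replicate, sqrtF_iterate,
    subFn_boolPair, bitsToNat_encodeNat, binToUnaryFn_boolPair, id_eq, linv]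
  rw [min_eq_left ((Nat.sub_le _ _).trans (iterate_sqrt_le J m))]

/-- `sqrtF ∈ FP` (`natSqrt_mem_FP`). [folklore] -/
theorem sqrtF_mem_FP : sqrtF ∈ FP := natSqrt_mem_FP

/-- `nOfM J c₀ ∈ FP`. [folklore] -/
theorem nOfM_mem_FP (J c₀ : ℕ) : nOfM J c₀ ∈ FP :=
  comp_mem_FP binToUnaryFn_mem_FP (fanoutFn_mem_FP OracleCompose.id_mem_FP
    (comp_mem_FP subFn_mem_FP (comp_mem_FP (fanoutFn_mem_FP OracleCompose.id_mem_FP (const_mem_FP _))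
      (comp_mem_FP (iterate_mem_FP' sqrtF_mem_FP J) lenBinF_mem_FP))))

/-- The preparation of slots `1 … 6`: `⟨1ᵐ, r⟩ ↦ ⟨1^{linv m}, r⟩`. [cite: ChenEtAl2022, §5.1 (Lemma 5.1)] -/
def prepF (J c₀ : ℕ) : List Bool → List Bool := fanoutFn (nOfM J c₀ ∘ fstF) sndF

/-- Value of `prepF` on `⟨1ᵐ, r⟩`. [folklore] -/
theorem prepF_apply (J c₀ m : ℕ) (r : List Bool) :
    prepF J c₀ (boolPair (ones m) r) = boolPair (ones (linv J c₀ m)) r := by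
  simp only [prepF, fanoutFn_apply, Function.comp_apply, fstF_boolPair, sndF_boolPair, nOfM_ones]

/-- `prepF J c₀ ∈ FP`. [folklore] -/
theorem prepF_mem_FP (J c₀ : ℕ) : prepF J c₀ ∈ FP :=
  fanoutFn_mem_FP (comp_mem_FP (nOfM_mem_FP J c₀) fstF_mem_FP) sndF_mem_FP

/-! #### The randomised refuters -/

/-- **The refuter of slot `i`** as a probabilistic algorithm on the unary input `1ᵐ` (Gill machine,
coin budget exactly `Q(m)`): run the list-refuter on `⟨P ⟨1ᵐ, r⟩⟩ = ⟨1ⁿ, r⟩` and print entry `i`.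
[cite: ChenEtAl2022, §5.1 (Lemma 5.1 with the proof of Thm. 5.2, case `𝒞 = BPP`)] -/
def refuter (P : List Bool → List Bool) (i : Fin 7) (Q : Polynomial ℕ) : RandAlg ℕ (List Bool) where
  run m r := κ.refF P i (boolPair (unaryEncodeNat m) r)
  coinLen m := Q.eval m

variable {κ} in
include hf₁ hf₀ hpad hA' in
/-- **The refuters are probabilistic polynomial time.** [cite: ChenEtAl2022, §5.1 (Lemma 5.1)] -/
theorem isPolyTime_refuter {P : List Bool → List Bool} (hP : P ∈ FP) (i : Fin 7) (Q : Polynomial ℕ) :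
    (κ.refuter P i Q).IsPolyTime unaryEncodeNat (id : List Bool → List Bool) := by
  have h : PolyTimeComputable (id : List Bool → List Bool) (id : List Bool → List Bool) (κ.refF P i) :=
    refF_mem_FP hf₁ hf₀ hpad hA' hP i
  refine ⟨?_, Q, fun m => le_rfl⟩
  exact PolyTimeComputable.of_encode_eq (ea := (id : List Bool → List Bool)) (eb := (id : List Bool → List Bool))
    (f := κ.refF P i) (ea' := fun p : ℕ × List Bool => boolPair (unaryEncodeNat p.1) p.2)
    (eb' := (id : List Bool → List Bool)) (f' := Function.uncurry (κ.refuter P i Q).run)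
    (fun p : ℕ × List Bool => boolPair (unaryEncodeNat p.1) p.2) (fun _ => rfl) (fun _ => rfl) h

/-- The coin budget is literally the polynomial `Q`. [folklore] -/
theorem coinLen_refuter (P : List Bool → List Bool) (i : Fin 7) (Q : Polynomial ℕ) (m : ℕ) :
    (κ.refuter P i Q).coinLen m = Q.eval m := rfl

/-- Monotonicity of `uniformProb` (local copy). [folklore] -/
theorem uniformProb_mono_set {m : ℕ} {E E' : Set (List Bool)} (h : E ⊆ E') : uniformProb m E ≤ uniformProb m E' := by
  classical
  unfold uniformProb
  refine div_le_div_of_nonneg_right ?_ (by positivity)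
  exact_mod_cast Finset.card_le_card fun r hr => by
    simp only [Finset.mem_filter, Finset.mem_univ, true_and] at hr ⊢
    exact h hr

/-- **Success bound of a refuter** (pseudo-determinism): if the preparation sends `1ᵐ` to `1ⁿ`,
the coin budget covers `4n` blocks, the canonical queries have length `ℓ(n)` and are each answered
wrongly with probability `≤ 2^{-ℓ(n)}`, then the refuter of slot `i` prints the canonical entry `i`
— hence hits any event containing it — with probability `≥ 1 - 4n·2^{-ℓ(n)}`.
[cite: ChenEtAl2022, §5.1 (proof of Thm. 5.2, case `𝒞 = BPP`: "our randomized refuters are pseudo-deterministic")] -/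
theorem pr_refuter_ge (A : Language Bool) {P : List Bool → List Bool} {i : Fin 7} {Q : Polynomial ℕ} {m n : ℕ}
    (hP : ∀ r : List Bool, P (boolPair (ones m) r) = boolPair (ones n) r)
    (hQ : 4 * n * κ.K n ≤ Q.eval m)
    (hlen : ∀ t < 4 * n, (κ.cqry A n t).length = κ.ℓ.eval n)
    (hamp : ∀ y : List Bool, y.length = κ.ℓ.eval n →
      uniformProb (κ.qA.eval y.length) (κ.badCoins A y) ≤ 1 / 2 ^ (κ.ℓ.eval n))
    {E : Set (List Bool)} (hE : κ.slotVal n (κ.canon A n n).2 i ∈ E) :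
    1 - 4 * n * (1 / 2 ^ (κ.ℓ.eval n)) ≤ (κ.refuter P i Q).pr unaryEncodeNat m E := by
  rw [RandAlg.pr_eq_uniformProb]
  have hm : (unaryEncodeNat m).length = m := by
    rw [OracleCompose.unaryEncodeNat_eq_replicate, List.length_replicate]
  rw [coinLen_refuter, hm]
  have hsub : {r : List Bool | κ.Good A n r} ⊆ {r | (κ.refuter P i Q).run m r ∈ E} := by
    intro r hr
    have hv : P (boolPair (unaryEncodeNat m) r) = boolPair (ones n) r := by
      rw [OracleCompose.unaryEncodeNat_eq_replicate]; exact hP r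
    show κ.refF P i (boolPair (unaryEncodeNat m) r) ∈ E
    rw [κ.refF_apply hv, finState, κ.iterate_pureStep_eq_canon hr n le_rfl]
    exact hE
  have h1 := uniformProb_mono_set (m := Q.eval m) hsub
  have h2 := κ.uniformProb_not_good_le A n hlen hamp hQ
  have h3 : uniformProb (Q.eval m) {r : List Bool | ¬ κ.Good A n r} = 1 - uniformProb (Q.eval m) {r | κ.Good A n r} := by
    have e : ({r : List Bool | ¬ κ.Good A n r} : Set (List Bool)) = {r | κ.Good A n r}ᶜ := by
      ext r
      rfl
    rw [e, uniformProb_compl]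
  linarith

end Whole

end RefuterKit

end Literature.Computability.MetaComplexity
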